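import Summits.Ventures.PercRepro.Night2LocalD2R14SixZeroL

/-!
# PercRepro — the six-element columns of R1₄ without a far preimage, part M: the last cell `|G ∖ S| = 3`
(night-2, gen 16)

At `|G ∖ S| = 3` at most FIVE pair preimages have `|G ∖ cl B| = 3` (`card_three_le_five_of_three`, proofs/NIGHT-2-k1.md
§7.4): six would force each of the three points of `G ∖ S` into exactly four pair closures, hence onto a line
`cl {aᵢ, bᵢ}` (`exists_line_of_three_le`) with distinct pairs; the rich preimages are counted by the pairs of points they
contain, at most two per pair of points and at most one unless the two lines' pairs are disjoint — and three pairwise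
disjoint pairs do not fit in five points.
-/

namespace PercRepro.Shadow

open Finset PerFlat ThmH

variable {α : Type*} [DecidableEq α] {M : Matroid α} [M.Finite]

open scoped Classical in
/-- **The line structure**: if `g ∈ G ∖ S` lies in the closure of at least three pair preimages, there are two points
`a ≠ b` of `S ∖ {y}` with `g ∈ cl {a, b}` such that every pair preimage with `g` in its closure has pair set `{a, b}`
or a 2-subset of `S ∖ {y, a, b}`. -/
theorem exists_line_of_three_le {G : Finset α} (hG : G ∈ flatsQ M (4 + 1))
    (hsimple : ∀ e ∈ gr M, ∀ f ∈ gr M, e ≠ f → rkN M {e, f} = 2) {y : α} (hyG : y ∈ G)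
    (hyc : y ∉ clF M (G.erase y)) {S : Finset α} (hS : S ∈ shadowAt M (4 + 2) 4 (Uq M (4 + 2) 4) G)
    (h6 : S.card = 6) {g : α} (hg : g ∈ G \ S)
    (h3 : 3 ≤ ((pairPre M 4 G S).filter (fun B => g ∈ clF M B)).card) :
    ∃ a b, a ∈ S.erase y ∧ b ∈ S.erase y ∧ a ≠ b ∧ g ∈ clF M ({a, b} : Finset α) ∧
      ∀ B ∈ pairPre M 4 G S, g ∈ clF M B →
        S \ B ∈ insert ({a, b} : Finset α) (Finset.powersetCard 2 ((S.erase y) \ {a, b})) := by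
  have hGg : G ⊆ gr M := (mem_flatsQ.1 hG).1
  have hSG : S ⊆ G := subset_of_mem_shadowAt hS
  have hyS : y ∈ S := mem_of_mem_shadowAt_of_coloop (by rw [rkN_erase_eq_of_coloop hG hyG hyc]) hS
  have hgS : g ∉ S := (Finset.mem_sdiff.1 hg).2
  have hgG : g ∈ G := (Finset.mem_sdiff.1 hg).1
  -- pair sets are 2-subsets of `S ∖ {y}`
  have hXU : ∀ B ∈ pairPre M 4 G S, S \ B ⊆ S.erase y := by
    intro B hB e he
    rw [Finset.mem_erase]
    exact ⟨fun h => (Finset.mem_sdiff.1 he).2 (h ▸ mem_of_mem_pairPre hG hyG hyc hB), (Finset.mem_sdiff.1 he).1⟩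
  have hU5 : (S.erase y).card = 5 := by rw [Finset.card_erase_of_mem hyS, h6]
  set 𝓕 := (pairPre M 4 G S).filter (fun B => g ∈ clF M B) with h𝓕def
  have hcard : 2 < 𝓕.card := by omega
  rw [Finset.two_lt_card_iff] at hcard
  obtain ⟨B₁, B₂, B₃, hB₁, hB₂, hB₃, h₁₂, h₁₃, h₂₃⟩ := hcard
  rw [h𝓕def, Finset.mem_filter] at hB₁ hB₂ hB₃
  -- two of `X₁, X₂, X₃` share a point
  have hmeet : ∃ B B' : Finset α, B ∈ pairPre M 4 G S ∧ B' ∈ pairPre M 4 G S ∧ B ≠ B' ∧ g ∈ clF M B ∧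
      g ∈ clF M B' ∧ ((S \ B) ∩ (S \ B')).Nonempty := by
    by_cases h12 : ((S \ B₁) ∩ (S \ B₂)).Nonempty
    · exact ⟨B₁, B₂, hB₁.1, hB₂.1, h₁₂, hB₁.2, hB₂.2, h12⟩
    by_cases h13 : ((S \ B₁) ∩ (S \ B₃)).Nonempty
    · exact ⟨B₁, B₃, hB₁.1, hB₃.1, h₁₃, hB₁.2, hB₃.2, h13⟩
    -- `X₂, X₃ ⊆ (S ∖ y) ∖ X₁`, a 3-set
    refine ⟨B₂, B₃, hB₂.1, hB₃.1, h₂₃, hB₂.2, hB₃.2, ?_⟩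
    rw [Finset.not_nonempty_iff_eq_empty] at h12 h13
    have hsub : ∀ B ∈ pairPre M 4 G S, (S \ B₁) ∩ (S \ B) = ∅ → S \ B ⊆ (S.erase y) \ (S \ B₁) := by
      intro B hB hdis e he
      rw [Finset.mem_sdiff]
      refine ⟨hXU B hB he, fun h => ?_⟩
      have : e ∈ (S \ B₁) ∩ (S \ B) := Finset.mem_inter.2 ⟨h, he⟩
      rw [hdis] at this
      exact Finset.notMem_empty _ this
    have hT : ((S.erase y) \ (S \ B₁)).card = 3 := by
      rw [Finset.card_sdiff_of_subset (hXU B₁ hB₁.1), hU5, card_sdiff_of_mem_pairPre hB₁.1]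
    exact inter_nonempty_of_subset_three hT (hsub B₂ hB₂.1 h12) (hsub B₃ hB₃.1 h13)
      (card_sdiff_of_mem_pairPre hB₂.1) (card_sdiff_of_mem_pairPre hB₃.1)
  obtain ⟨B, B', hB, hB', hne, hgB, hgB', hmeet⟩ := hmeet
  obtain ⟨hc3, hyI, hI⟩ := clF_inter_subset_of_meet hG hsimple hyG hyc hS h6 hB hB' hne hmeet
  -- `B ∩ B' = {y, a, b}`; `g ∈ cl {a, b}`
  obtain ⟨a, b, hab, hab_eq⟩ : ∃ a b, a ≠ b ∧ (B ∩ B').erase y = {a, b} := by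
    have : ((B ∩ B').erase y).card = 2 := by rw [Finset.card_erase_of_mem hyI, hc3]
    exact Finset.card_eq_two.1 this
  have haI : a ∈ (B ∩ B').erase y := by rw [hab_eq]; simp
  have hbI : b ∈ (B ∩ B').erase y := by rw [hab_eq]; simp
  rw [Finset.mem_erase] at haI hbI
  have haS : a ∈ S := subset_of_mem_pairPre hB (Finset.mem_inter.1 haI.2).1
  have hbS : b ∈ S := subset_of_mem_pairPre hB (Finset.mem_inter.1 hbI.2).1
  have hgΛ : g ∈ clF M (B ∩ B') := hI (Finset.mem_inter.2 ⟨hgB, hgB'⟩)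
  have hIeq : B ∩ B' = insert y {a, b} := by rw [← hab_eq, Finset.insert_erase hyI]
  rw [hIeq] at hgΛ
  have habG : ({a, b} : Finset α) ⊆ G.erase y := by
    intro e he
    rw [Finset.mem_insert, Finset.mem_singleton] at he
    rcases he with rfl | rfl
    · exact Finset.mem_erase.2 ⟨haI.1, hSG haS⟩
    · exact Finset.mem_erase.2 ⟨hbI.1, hSG hbS⟩
  have hgy : g ≠ y := fun h => hgS (h ▸ hyS)
  have hgℓ : g ∈ clF M ({a, b} : Finset α) :=
    mem_clF_of_mem_clF_insert_coloop hyc habG (Finset.mem_erase.2 ⟨hgy, hgG⟩) hgΛ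
  have hga : g ≠ a := fun h => hgS (h ▸ haS)
  have hgb : g ≠ b := fun h => hgS (h ▸ hbS)
  -- exchange: `g ∈ cl {a, b} ∖ cl {a}` gives `b ∈ cl {a, g}`, and symmetrically `a ∈ cl {b, g}`
  have hexch : ∀ u v : α, u ∈ S → v ∈ S → g ≠ u → g ∈ clF M ({u, v} : Finset α) → v ∈ clF M ({u, g} : Finset α) := by
    intro u v huS hvS hgu hguv
    rw [mem_clF_iff] at hguv ⊢
    have hgu' : g ∉ M.closure ({u} : Set α) := by
      intro h
      have h1 : ({u, g} : Finset α) ⊆ clF M {u} := by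
        intro e he
        rw [Finset.mem_insert, Finset.mem_singleton] at he
        rcases he with rfl | rfl
        · exact subset_clF_of_subset_gr (Finset.singleton_subset_iff.2 (hGg (hSG huS))) (Finset.mem_singleton_self _)
        · rw [mem_clF_iff]; exact_mod_cast h
      have h2 := rkN_le_of_subset_clF' (M := M) h1
      have h3 := rkN_le_card_fin (M := M) ({u} : Finset α)
      rw [Finset.card_singleton] at h3
      have h4 := hsimple u (hGg (hSG huS)) g (hGg hgG) hgu.symm
      omega
    have hguv' : g ∈ M.closure (insert v ({u} : Set α)) := by
      have : ((({u, v} : Finset α)) : Set α) = insert v ({u} : Set α) := by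
        push_cast
        exact Set.pair_comm u v
      rw [← this]
      exact_mod_cast hguv
    have := Matroid.mem_closure_insert hgu' hguv'
    have hcoe : ((({u, g} : Finset α)) : Set α) = insert g ({u} : Set α) := by
      push_cast
      exact Set.pair_comm u g
    rw [hcoe]
    exact this
  -- every pair preimage with `g` in its closure has pair set `{a, b}` or a 2-subset of `S ∖ {y, a, b}`
  have hform : ∀ B'' ∈ pairPre M 4 G S, g ∈ clF M B'' →
      S \ B'' ∈ insert ({a, b} : Finset α) (Finset.powersetCard 2 ((S.erase y) \ {a, b})) := by
    intro B'' hB'' hgB''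
    have hUB'' : B'' ∈ Uq M (4 + 2) 4 := (mem_membersIn.1 (mem_pairPre.1 hB'').1).1
    have key : ∀ u v : α, u ∈ S → v ∈ S → g ≠ u → g ∈ clF M ({u, v} : Finset α) → u ∈ B'' → v ∈ clF M B'' := by
      intro u v huS hvS hgu hguv huB''
      have h1 := hexch u v huS hvS hgu hguv
      have h2 : ({u, g} : Finset α) ⊆ clF M B'' :=
        Finset.insert_subset (subset_clF hUB'' huB'') (Finset.singleton_subset_iff.2 hgB'')
      exact clF_subset_clF_of_subset_clF h2 h1
    have hgba : g ∈ clF M ({b, a} : Finset α) := by rw [Finset.pair_comm]; exact hgℓ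
    rw [Finset.mem_insert, Finset.mem_powersetCard]
    by_cases haB : a ∈ B''
    · -- then `b ∈ cl B''`, so `b ∉ X` and `a ∉ X`
      have hbcl := key a b haS hbS hga hgℓ haB
      right
      refine ⟨?_, card_sdiff_of_mem_pairPre hB''⟩
      intro e he
      rw [Finset.mem_sdiff, Finset.mem_insert, Finset.mem_singleton, not_or]
      refine ⟨hXU B'' hB'' he, fun h => (Finset.mem_sdiff.1 he).2 (h ▸ haB), fun h => ?_⟩
      exact (Finset.mem_sdiff.1 (sdiff_subset_of_mem_pairPre hB'' he)).2 (h ▸ hbcl)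
    · by_cases hbB : b ∈ B''
      · have hacl := key b a hbS haS hgb hgba hbB
        exact absurd (subset_clF hUB'' (by
          by_contra h
          exact (Finset.mem_sdiff.1 (sdiff_subset_of_mem_pairPre hB'' (Finset.mem_sdiff.2 ⟨haS, h⟩))).2 hacl)) (fun h => haB (by
            by_contra h'
            exact (Finset.mem_sdiff.1 (sdiff_subset_of_mem_pairPre hB'' (Finset.mem_sdiff.2 ⟨haS, h'⟩))).2 h))
      · left
        symm
        apply Finset.eq_of_subset_of_card_le
        · intro e he
          rw [Finset.mem_insert, Finset.mem_singleton] at he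
          rcases he with rfl | rfl
          · exact Finset.mem_sdiff.2 ⟨haS, haB⟩
          · exact Finset.mem_sdiff.2 ⟨hbS, hbB⟩
        · rw [card_sdiff_of_mem_pairPre hB'', Finset.card_pair hab]
  exact ⟨a, b, Finset.mem_erase.2 ⟨haI.1, haS⟩, Finset.mem_erase.2 ⟨hbI.1, hbS⟩, hab, hgℓ, hform⟩


open scoped Classical in
/-- The admissible pair sets at a line `{a, b}` number four, and a point in four pair closures realises all of them;
in particular `{a, b}` itself is the pair set of a pair preimage whose closure contains `g`. -/
theorem exists_pairPre_sdiff_eq_of_four {G : Finset α} (hG : G ∈ flatsQ M (4 + 1))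
    (hsimple : ∀ e ∈ gr M, ∀ f ∈ gr M, e ≠ f → rkN M {e, f} = 2) {y : α} (hyG : y ∈ G)
    (hyc : y ∉ clF M (G.erase y)) {S : Finset α} (hS : S ∈ shadowAt M (4 + 2) 4 (Uq M (4 + 2) 4) G)
    (h6 : S.card = 6) {g : α} (hg : g ∈ G \ S)
    (h4 : 4 ≤ ((pairPre M 4 G S).filter (fun B => g ∈ clF M B)).card) :
    ∃ a b, a ∈ S.erase y ∧ b ∈ S.erase y ∧ a ≠ b ∧ g ∈ clF M ({a, b} : Finset α) ∧
      (∀ B ∈ pairPre M 4 G S, g ∈ clF M B →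
        S \ B ∈ insert ({a, b} : Finset α) (Finset.powersetCard 2 ((S.erase y) \ {a, b}))) ∧
      ∃ B₀ ∈ pairPre M 4 G S, g ∈ clF M B₀ ∧ S \ B₀ = {a, b} := by
  obtain ⟨a, b, ha, hb, hab, hgℓ, hform⟩ := exists_line_of_three_le hG hsimple hyG hyc hS h6 hg (by omega)
  refine ⟨a, b, ha, hb, hab, hgℓ, hform, ?_⟩
  have hyS : y ∈ S := mem_of_mem_shadowAt_of_coloop (by rw [rkN_erase_eq_of_coloop hG hyG hyc]) hS
  set 𝓕 := (pairPre M 4 G S).filter (fun B => g ∈ clF M B) with h𝓕def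
  set A := insert ({a, b} : Finset α) (Finset.powersetCard 2 ((S.erase y) \ {a, b})) with hAdef
  have hAc : A.card = 4 := by
    rw [hAdef, Finset.card_insert_of_notMem, Finset.card_powersetCard]
    · have h3 : ((S.erase y) \ {a, b}).card = 3 := by
        have := Finset.card_sdiff_add_card_eq_card (show ({a, b} : Finset α) ⊆ S.erase y from by
          intro e he
          rw [Finset.mem_insert, Finset.mem_singleton] at he
          rcases he with rfl | rfl
          · exact ha
          · exact hb)
        rw [Finset.card_pair hab, Finset.card_erase_of_mem hyS, h6] at this
        omega
      rw [h3]
      decide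
    · intro h
      rw [Finset.mem_powersetCard] at h
      have := h.1 (Finset.mem_insert_self a {b})
      rw [Finset.mem_sdiff] at this
      exact this.2 (Finset.mem_insert_self a {b})
  have hmaps : ∀ B ∈ 𝓕, S \ B ∈ A := by
    intro B hB
    rw [h𝓕def, Finset.mem_filter] at hB
    exact hform B hB.1 hB.2
  have hinj : Set.InjOn (fun B => S \ B) (𝓕 : Set (Finset α)) := by
    intro B hB B' hB' h
    rw [Finset.mem_coe, h𝓕def, Finset.mem_filter] at hB hB'
    by_contra hne
    exact sdiff_ne_of_mem_pairPre hB.1 hB'.1 hne h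
  have himg : Finset.image (fun B => S \ B) 𝓕 = A := by
    apply Finset.eq_of_subset_of_card_le
    · intro X hX
      rw [Finset.mem_image] at hX
      obtain ⟨B, hB, rfl⟩ := hX
      exact hmaps B hB
    · rw [Finset.card_image_of_injOn hinj, hAc]
      exact h4
  have hab' : ({a, b} : Finset α) ∈ Finset.image (fun B => S \ B) 𝓕 := by
    rw [himg, hAdef]
    exact Finset.mem_insert_self _ _
  rw [Finset.mem_image] at hab'
  obtain ⟨B₀, hB₀, hX₀⟩ := hab'
  rw [h𝓕def, Finset.mem_filter] at hB₀
  exact ⟨B₀, hB₀.1, hB₀.2, hX₀⟩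

open scoped Classical in
/-- Two points of `G ∖ S` in four pair closures each have distinct lines. -/
theorem line_ne_of_ne {G : Finset α} (hG : G ∈ flatsQ M (4 + 1))
    (hsimple : ∀ e ∈ gr M, ∀ f ∈ gr M, e ≠ f → rkN M {e, f} = 2) {S : Finset α}
    (hS : S ∈ shadowAt M (4 + 2) 4 (Uq M (4 + 2) 4) G)
    {g g' : α} (hg : g ∈ G \ S) (hg' : g' ∈ G \ S) (hgg : g ≠ g') {a b : α} (hgℓ : g ∈ clF M ({a, b} : Finset α))
    (hg'ℓ : g' ∈ clF M ({a, b} : Finset α)) {B₀ : Finset α} (hB₀ : B₀ ∈ pairPre M 4 G S) (hgB₀ : g ∈ clF M B₀)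
    (hg'B₀ : g' ∈ clF M B₀) (hX₀ : S \ B₀ = {a, b}) : False := by
  have hGg : G ⊆ gr M := (mem_flatsQ.1 hG).1
  have hSG : S ⊆ G := subset_of_mem_shadowAt hS
  have haS : a ∈ S := (Finset.mem_sdiff.1 (by rw [hX₀]; exact Finset.mem_insert_self a {b} : a ∈ S \ B₀)).1
  have hbS : b ∈ S := (Finset.mem_sdiff.1 (by rw [hX₀]; simp : b ∈ S \ B₀)).1
  -- `cl {a, b} ⊆ cl {g, g'}` (both of rank `2`)
  have hgg2 : rkN M ({g, g'} : Finset α) = 2 := hsimple g (hGg (Finset.mem_sdiff.1 hg).1) g' (hGg (Finset.mem_sdiff.1 hg').1) hgg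
  have hsub : ({g, g'} : Finset α) ⊆ clF M ({a, b} : Finset α) := by
    intro e he
    rw [Finset.mem_insert, Finset.mem_singleton] at he
    rcases he with rfl | rfl
    · exact hgℓ
    · exact hg'ℓ
  have hclSG : clF M S ⊆ G := by
    intro e he
    rw [mem_clF_iff] at he
    have h1 : M.closure (S : Set α) ⊆ M.closure (G : Set α) := M.closure_subset_closure (by exact_mod_cast hSG)
    have h2 : M.closure (G : Set α) = G := (mem_flatsQ.1 hG).2.1.closure
    rw [h2] at h1
    exact_mod_cast h1 he
  have hab_sub : ({a, b} : Finset α) ⊆ S := by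
    intro e he
    rw [Finset.mem_insert, Finset.mem_singleton] at he
    rcases he with rfl | rfl
    · exact haS
    · exact hbS
  have habg : clF M ({a, b} : Finset α) ⊆ gr M := (clF_mono hab_sub).trans (hclSG.trans hGg)
  have hrab : rkN M (clF M ({a, b} : Finset α)) ≤ 2 := by
    have h1 : rkN M (clF M ({a, b} : Finset α)) ≤ rkN M ({a, b} : Finset α) := rkN_le_of_subset_clF' (M := M) (le_refl _)
    have h2 := rkN_le_card_fin (M := M) ({a, b} : Finset α)
    have h3 := Finset.card_le_two (a := a) (b := b)
    omega
  have heq : rkN M ({g, g'} : Finset α) = rkN M (clF M ({a, b} : Finset α)) := by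
    have := rkN_mono (M := M) hsub
    omega
  have hcl := subset_closure_of_rkN_eq (M := M) habg hsub heq
  have haB₀ : a ∈ clF M B₀ := by
    have ha' : a ∈ clF M ({g, g'} : Finset α) := by
      rw [mem_clF_iff]
      exact hcl (Finset.mem_coe.2 (subset_clF_of_subset_gr (by
        intro e he
        rw [Finset.mem_insert, Finset.mem_singleton] at he
        rcases he with rfl | rfl
        · exact hGg (hSG haS)
        · exact hGg (hSG hbS)) (Finset.mem_insert_self a {b})))
    have h2 : ({g, g'} : Finset α) ⊆ clF M B₀ := by
      intro e he
      rw [Finset.mem_insert, Finset.mem_singleton] at he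
      rcases he with rfl | rfl
      · exact hgB₀
      · exact hg'B₀
    exact clF_subset_clF_of_subset_clF h2 ha'
  have : a ∈ S \ B₀ := by rw [hX₀]; exact Finset.mem_insert_self a {b}
  exact (Finset.mem_sdiff.1 (sdiff_subset_of_mem_pairPre hB₀ this)).2 haB₀

open scoped Classical in
/-- **The rich preimages containing two given points**: with the line structure at `g` (pair `P`) and at `g'` (pair
`P'`, `P ≠ P'`), the pair preimages whose closures contain both `g` and `g'` number at most `2`, and at most `1`
unless `P` and `P'` are disjoint. -/
theorem card_filter_two_points_le {G : Finset α} {y : α} {S : Finset α} (hyS : y ∈ S) (h6 : S.card = 6)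
    {g g' : α} {P P' : Finset α} (hP : P ⊆ S.erase y) (hP' : P' ⊆ S.erase y) (hPc : P.card = 2) (hP'c : P'.card = 2)
    (hne : P ≠ P')
    (hform : ∀ B ∈ pairPre M 4 G S, g ∈ clF M B → S \ B ∈ insert P (Finset.powersetCard 2 ((S.erase y) \ P)))
    (hform' : ∀ B ∈ pairPre M 4 G S, g' ∈ clF M B → S \ B ∈ insert P' (Finset.powersetCard 2 ((S.erase y) \ P'))) :
    ((pairPre M 4 G S).filter (fun B => g ∈ clF M B ∧ g' ∈ clF M B)).card ≤ (if Disjoint P P' then 2 else 1) := by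
  have hU5 : (S.erase y).card = 5 := by rw [Finset.card_erase_of_mem hyS, h6]
  set F := (pairPre M 4 G S).filter (fun B => g ∈ clF M B ∧ g' ∈ clF M B) with hFdef
  have hinj : Set.InjOn (fun B => S \ B) (F : Set (Finset α)) := by
    intro B hB B' hB' h
    rw [Finset.mem_coe, hFdef, Finset.mem_filter] at hB hB'
    by_contra hne'
    exact sdiff_ne_of_mem_pairPre hB.1 hB'.1 hne' h
  have hboth : ∀ B ∈ F, (S \ B = P ∨ S \ B ⊆ (S.erase y) \ P) ∧ (S \ B = P' ∨ S \ B ⊆ (S.erase y) \ P') ∧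
      (S \ B).card = 2 := by
    intro B hB
    rw [hFdef, Finset.mem_filter] at hB
    have h1 := hform B hB.1 hB.2.1
    have h2 := hform' B hB.1 hB.2.2
    rw [Finset.mem_insert, Finset.mem_powersetCard] at h1 h2
    refine ⟨?_, ?_, card_sdiff_of_mem_pairPre hB.1⟩
    · rcases h1 with h | h
      · exact Or.inl h
      · exact Or.inr h.1
    · rcases h2 with h | h
      · exact Or.inl h
      · exact Or.inr h.1
  split_ifs with hdisj
  · -- disjoint: every pair set is `P` or `P'`
    have hmaps : ∀ B ∈ F, S \ B ∈ ({P, P'} : Finset (Finset α)) := by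
      intro B hB
      obtain ⟨h1, h2, hc⟩ := hboth B hB
      rw [Finset.mem_insert, Finset.mem_singleton]
      rcases h1 with h1 | h1
      · exact Or.inl h1
      · rcases h2 with h2 | h2
        · exact Or.inr h2
        · exfalso
          -- `S ∖ B ⊆ (S ∖ y) ∖ (P ∪ P')`, a set of one element
          have hsub : S \ B ⊆ (S.erase y) \ (P ∪ P') := by
            intro e he
            rw [Finset.mem_sdiff, Finset.mem_union, not_or]
            exact ⟨(Finset.mem_sdiff.1 (h1 he)).1, (Finset.mem_sdiff.1 (h1 he)).2, (Finset.mem_sdiff.1 (h2 he)).2⟩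
          have hc1 : ((S.erase y) \ (P ∪ P')).card = 1 := by
            have := Finset.card_sdiff_add_card_eq_card (Finset.union_subset hP hP')
            rw [Finset.card_union_of_disjoint hdisj, hPc, hP'c, hU5] at this
            omega
          have := Finset.card_le_card hsub
          omega
    have h1 := Finset.card_le_card_of_injOn (fun B => S \ B) hmaps hinj
    have h2 : ({P, P'} : Finset (Finset α)).card = 2 := Finset.card_pair hne
    omega
  · -- sharing a point: every pair set is the 2-set `(S ∖ y) ∖ (P ∪ P')`
    have hsub : ∀ B ∈ F, S \ B = (S.erase y) \ (P ∪ P') := by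
      intro B hB
      obtain ⟨h1, h2, hc⟩ := hboth B hB
      have hshare : ∃ e, e ∈ P ∧ e ∈ P' := by
        by_contra h
        push Not at h
        exact hdisj (Finset.disjoint_left.2 h)
      obtain ⟨e, heP, heP'⟩ := hshare
      have hXP : S \ B ⊆ (S.erase y) \ P := by
        rcases h1 with h1 | h1
        · exfalso
          rcases h2 with h2 | h2
          · exact hne (h1.symm.trans h2)
          · have := h2 (h1 ▸ heP)
            exact (Finset.mem_sdiff.1 this).2 heP'
        · exact h1
      have hXP' : S \ B ⊆ (S.erase y) \ P' := by
        rcases h2 with h2 | h2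
        · exfalso
          rcases h1 with h1 | h1
          · exact hne (h1.symm.trans h2)
          · have := h1 (h2 ▸ heP')
            exact (Finset.mem_sdiff.1 this).2 heP
        · exact h2
      have hsub' : S \ B ⊆ (S.erase y) \ (P ∪ P') := by
        intro t ht
        rw [Finset.mem_sdiff, Finset.mem_union, not_or]
        exact ⟨(Finset.mem_sdiff.1 (hXP ht)).1, (Finset.mem_sdiff.1 (hXP ht)).2, (Finset.mem_sdiff.1 (hXP' ht)).2⟩
      apply Finset.eq_of_subset_of_card_le hsub'
      have hu : (P ∪ P').card ≤ 3 := by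
        have := Finset.card_union_add_card_inter P P'
        have hpos : 0 < (P ∩ P').card := Finset.card_pos.2 ⟨e, Finset.mem_inter.2 ⟨heP, heP'⟩⟩
        omega
      have hu3 : 3 ≤ (P ∪ P').card := by
        by_contra h
        push Not at h
        have e1 : P = P ∪ P' := Finset.eq_of_subset_of_card_le Finset.subset_union_left (by omega)
        have e2 : P' = P ∪ P' := Finset.eq_of_subset_of_card_le Finset.subset_union_right (by omega)
        exact hne (e1.trans e2.symm)
      have := Finset.card_sdiff_add_card_eq_card (Finset.union_subset hP hP')
      rw [hU5] at this
      omega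
    rw [Finset.card_le_one]
    intro B hB B' hB'
    have h := (hsub B hB).trans (hsub B' hB').symm
    by_contra hne'
    exact sdiff_ne_of_mem_pairPre (Finset.mem_filter.1 hB).1 (Finset.mem_filter.1 hB').1 hne' h

end PercRepro.Shadow
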